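import Literature.Analysis.FluidPDE.AlexakisDoeringProofs
import Literature.Analysis.FluidPDE.NSEnstrophyLimit2D
import Literature.Analysis.FluidPDE.NSStrongSolutions2D
import Literature.Analysis.FunctionSpaces.TorusFourierCalculus
import HarnessLib

/-!
# Alexakis–Doering's `χ ≤ k_f² U F` for every 2-D Leray–Hopf solution, relative to
  two-dimensional uniqueness

Trunk: FluidKinetic (`Literature/Analysis/FluidPDE`). Assembly file for the named fact
`Literature.Analysis.FluidPDE.AlexakisDoering2006_enstrophyDissipation_le`
(Alexakis–Doering, *Energy and enstrophy dissipation in steady state 2d turbulence*, Phys. Lett.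
A 359 (2006), §2, display "(VBI)" / arXiv:physics/0605090 eq. (16): `χ ≤ k_f² U F`, for every
global Leray–Hopf solution of the 2-D Navier–Stokes equations on the unit torus forced by
`F Φ(n • x)` with smooth datum).

`AlexakisDoeringProofs` proves the bound for every solution satisfying the integrated enstrophy
inequality `ν∫₀ᵗ‖Δu‖₂² ≤ ½‖∇u₀‖₂² - ∫₀ᵗ∫⟪Δf, u⟫`
(`meanEnstrophyDissipation_le_of_enstrophyIneq`), and `NSEnstrophyLimit2D` proves that
inequality for the Galerkin-limit solution (`NS.exists_isGlobalLerayHopf_enstrophyIneq_fin_two`).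
The remaining input is that the given Leray–Hopf solution *is* that solution: uniqueness of
Leray–Hopf weak solutions in two dimensions (Lions–Prodi 1959; Foias–Manley–Rosa–Temam 2001,
Ch. II Thm. 7.3), the tree's named fact `lions_prodi_uniqueness_torus2` (`NSUniqueness2D`). This
file proves:

* `lions_prodi_uniqueness_torus2.enstrophyIneq` — under 2-D uniqueness, EVERY global
  Leray–Hopf solution on `𝕋²` with smooth steady force and `L² ∩ H¹` weakly divergence-free datum
  satisfies the enstrophy inequality (exact force term) and has `∫₀ᵗ‖Δu‖₂² < ∞`
  (agreement a.e. at every positive time, `lions_prodi_uniqueness_torus2.global`; every term sees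
  only a.e.-classes, `eLaplacianNormSq_congr_ae` of `NSStrongSolutions2D`);
* `AlexakisDoering2006_enstrophyDissipation_le_of_lionsProdi` —
  `lions_prodi_uniqueness_torus2 → AlexakisDoering2006_enstrophyDissipation_le`.

So the trust base of "(VBI)" is reduced from the full 2-D regularity fact
`fmrt_enstrophy_balance_torus2` (`AlexakisDoering2006_enstrophyDissipation_le_of_enstrophyBalance`)
to 2-D uniqueness alone; the unconditional `…_holds` follows verbatim once
`lions_prodi_uniqueness_torus2` is discharged.

## References

* A. Alexakis, C. R. Doering, Phys. Lett. A 359 (2006), §2, display (VBI) / arXiv v1 eq. (16).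
  [AlexakisDoering2006PLA]
* C. Foias, O. Manley, R. Rosa, R. Temam, *Navier–Stokes Equations and Turbulence*, CUP 2001,
  Ch. II Thm. 7.3–7.4, App. II.A (A.65). [FoiasManleyRosaTemam2001]
-/

noncomputable section

open MeasureTheory Set Filter
open scoped ENNReal RealInnerProductSpace

namespace Literature.Analysis.FluidPDE

open Literature.Analysis.FunctionSpaces

variable {ν : ℝ} {f u₀ : UnitAddTorus (Fin 2) → EuclideanSpace ℝ (Fin 2)}
  {u : ℝ → UnitAddTorus (Fin 2) → EuclideanSpace ℝ (Fin 2)}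

/-- **The enstrophy inequality of EVERY global Leray–Hopf solution on `𝕋²`, under 2-D
uniqueness** (Foias–Manley–Rosa–Temam 2001, Ch. II: Thm. 7.3 uniqueness clause, identifying the
Leray–Hopf solution with the strong one of Thm. 7.4, whose enstrophy balance is (A.65)). Under
the named fact `lions_prodi_uniqueness_torus2` (`NSUniqueness2D`): for `ν > 0`, a smooth steady
force `f`, a datum `u₀ ∈ L² ∩ H¹` weakly divergence free and every global Leray–Hopf solution
`u`, for every `t > 0`: `∫₀ᵗ‖Δu‖₂² < ∞` and
`ν∫₀ᵗ‖Δu(s)‖₂² ds ≤ ½‖∇u₀‖₂² - ∫₀ᵗ∫⟪Δf, u(s)⟫ dx ds` — `u` agrees a.e. at every positive time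
with the Galerkin-limit solution of `NS.exists_isGlobalLerayHopf_enstrophyIneq_fin_two`
(`lions_prodi_uniqueness_torus2.global`), and every term only sees a.e.-classes of slices. [cite: FoiasManleyRosaTemam2001, Ch. II Thm. 7.3–7.4 and (A.65)] -/
theorem lions_prodi_uniqueness_torus2.enstrophyIneq (hU : lions_prodi_uniqueness_torus2)
    (hν : 0 < ν) (hf : Torus.IsSmooth f) (hu₀ : MemLp u₀ 2 volume)
    (hG : Torus.eGradNormSq u₀ ≠ ⊤) (hdiv : Torus.IsWeaklyDivFree u₀)
    (hu : Torus.IsGlobalLerayHopf ν (fun _ => f) u₀ u) {t : ℝ} (ht : 0 < t) :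
    ∫⁻ s in Ioo 0 t, eLaplacianNormSq (u s) ≠ ⊤ ∧
      ν * ∫ s in Ioc 0 t, (eLaplacianNormSq (u s)).toReal ≤
        2⁻¹ * (Torus.eGradNormSq u₀).toReal -
          ∫ s in Ioc 0 t, ∫ x, ⟪Torus.laplacian f x, u s x⟫ := by
  obtain ⟨v, hv, hvineq⟩ := exists_isGlobalLerayHopf_enstrophyIneq_fin_two hν hf hu₀ hG hdiv
  have hfm : AEStronglyMeasurable (Torus.stLift (fun _ : ℝ => f))
      (volume.restrict (Ioi 0 ×ˢ univ)) := aestronglyMeasurable_stLift_const hf _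
  have hf₂ : ∀ T, 0 < T → ∫⁻ t in Ioo 0 T, ∫⁻ x, ‖(fun _ : ℝ => f) t x‖ₑ ^ 2 < ⊤ :=
    fun T _ => lintegral_enorm_sq_const_lt_top hf T
  have hae : ∀ s, 0 < s → u s =ᵐ[volume] v s := fun s hs =>
    hU.global hν hfm hf₂ hu₀ hdiv hu hv hs
  obtain ⟨hne, hineq⟩ := hvineq t ht
  have h1 : ∫⁻ s in Ioo 0 t, eLaplacianNormSq (u s) = ∫⁻ s in Ioo 0 t, eLaplacianNormSq (v s) :=
    setLIntegral_congr_fun measurableSet_Ioo fun s hs => eLaplacianNormSq_congr_ae (hae s hs.1)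
  have h2 : ∫ s in Ioc 0 t, (eLaplacianNormSq (u s)).toReal =
      ∫ s in Ioc 0 t, (eLaplacianNormSq (v s)).toReal :=
    setIntegral_congr_fun measurableSet_Ioc fun s hs => by
      rw [eLaplacianNormSq_congr_ae (hae s hs.1)]
  have h3 : ∫ s in Ioc 0 t, ∫ x, ⟪Torus.laplacian f x, u s x⟫ =
      ∫ s in Ioc 0 t, ∫ x, ⟪Torus.laplacian f x, v s x⟫ :=
    setIntegral_congr_fun measurableSet_Ioc fun s hs => integral_congr_ae (by
      filter_upwards [hae s hs.1] with x hx
      rw [hx])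
  refine ⟨by rwa [h1], ?_⟩
  rw [h2, h3]
  exact hineq

/-- **Discharge of "(VBI)" relative to 2-D uniqueness**: the named fact
`lions_prodi_uniqueness_torus2` implies `AlexakisDoering2006_enstrophyDissipation_le`
(Alexakis–Doering 2006, §2, arXiv eq. (16) / display (VBI): `χ ≤ k_f² U F`), with the shape
constant `a = ‖ΔΦ‖_∞ + 1` of `AlexakisDoeringProofs`: the enstrophy inequality of every
Leray–Hopf solution (`lions_prodi_uniqueness_torus2.enstrophyIneq`; the smooth datum is in
`L² ∩ H¹` and weakly divergence free) is fed to the proved reduction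
`meanEnstrophyDissipation_le_of_enstrophyIneq`. Compared with
`AlexakisDoering2006_enstrophyDissipation_le_of_enstrophyBalance` the trust base shrinks from the
full 2-D regularity fact `fmrt_enstrophy_balance_torus2` to 2-D uniqueness alone. [cite: AlexakisDoering2006PLA, §2 eq. (16)] -/
theorem AlexakisDoering2006_enstrophyDissipation_le_of_lionsProdi
    (hU : lions_prodi_uniqueness_torus2) : AlexakisDoering2006_enstrophyDissipation_le := by
  intro Φ
  obtain ⟨M, hM, hb⟩ := exists_norm_laplacian_force_le Φ
  refine ⟨M + 1, by linarith, fun ν hν n hn F u₀ u hu₀ hu hUpos => ?_⟩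
  obtain ⟨hsm, -, -⟩ := ForcingShape.force_regular_holds Φ hn F
  have hK : 0 ≤ |F| * (n : ℝ) ^ 2 * M := by positivity
  have hineq : ∀ t, 0 < t → ν * ∫ s in Ioc 0 t, (eLaplacianNormSq (u s)).toReal ≤
      2⁻¹ * (Torus.eGradNormSq u₀).toReal -
        ∫ s in Ioc 0 t, ∫ x, ⟪Torus.laplacian (Φ.force n F) x, u s x⟫ := fun t ht =>
    (hU.enstrophyIneq hν hsm (hu₀.memLp 2) (Torus.eGradNormSq_lt_top hu₀).ne
      hu.isWeaklyDivFree_datum hu ht).2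
  have h := meanEnstrophyDissipation_le_of_enstrophyIneq hν hu hK (hb n F) hineq hUpos
  have hU0 : 0 ≤ rmsVelocity longTimeAvgSup u := Real.sqrt_nonneg _
  calc meanEnstrophyDissipation ν u ≤ |F| * (n : ℝ) ^ 2 * M * rmsVelocity longTimeAvgSup u := h
    _ ≤ (M + 1) * (n : ℝ) ^ 2 * |F| * rmsVelocity longTimeAvgSup u := by
        apply mul_le_mul_of_nonneg_right _ hU0
        nlinarith [abs_nonneg F, sq_nonneg (n : ℝ), mul_nonneg (abs_nonneg F) (sq_nonneg (n : ℝ))]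

end Literature.Analysis.FluidPDE

end
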